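import Mathlib
import Summits.Ventures.PercRepro2.HCov
import Summits.Ventures.PercRepro2.HCovCubic
import Summits.Ventures.PercRepro2.TriDisagreement
import Summits.Ventures.PercRepro2.TriDisagreementPinned
import Summits.Ventures.PercRepro2.TypedSplit
import Summits.Ventures.PercRepro2.OneTypedEdge
import Summits.Ventures.PercRepro2.StarPattern
import Summits.Ventures.PercRepro2.StarIdentities
import Summits.Ventures.PercRepro2.StarDebt
import Summits.Ventures.PercRepro2.ChainCoeff
import Summits.Ventures.PercRepro2.StarChain
import Summits.Ventures.PercRepro2.StarPayment
import Summits.Ventures.PercRepro2.StarRefine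
import Summits.Ventures.PercRepro2.StarRefineTwo

/-!
# The Möbius coefficients of the type-`2` refinement rows are chain coefficients (blind cell
PercRepro2, p1 g12; LEAD-CCW (c⁗⁗⁗) «complete monotonicity», CONJECTURES row 2′REFINE)

For `(t_S, k) = (2,1)`: `g(a) = Λ(T;T;a) + B(T₂)`, `g(ab) = 3 B(T₃) + Λ(T;T;a) + Λ(T;T;b) + B(T₂)`,
`g(abc) = 12 B(T₃) + Σ_c Λ(T;T;c) + B(T₂)`; for `(2,2)`: `g(a) = 2 Λ(T;T;a)`, `g(ab) = 12 B(T₃)`,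
`g(abc) = 24 B(T₃)` (`moebius_21_*`, `moebius_22_*`). `Λ(T;T;c)` is the chain `∅ ⊂ c ⊂ T` with
counts `(0,1,2)` (`Ltt_T_eq_chainCoeff`) and `B(T₃)` the chain `∅ ⊂ T` with counts `(0,3)`
(`Bfull_eq_chainCoeff`), so under row 2′TRI-CH every Möbius coefficient of these rows is `≥ 0`
(`moebius_21_nonneg_of_triCH`, `moebius_22_nonneg_of_triCH`): at `(2,1)` and `(2,2)` complete
monotonicity of the triple is a consequence of chain positivity alone; the only non-chain
coefficient of the family is `g(ab)` at `(1,1)` (`StarRefine.moebius_11_two`).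
NEG-108 (2026-08-24): the identities are unconditional; every positivity Prop is scoped in its
docstring to the one-rung-down objects of GRAPHS / the five-mark base (never typed hypergraphs).
-/

namespace Summit.Ventures.PercRepro2

open CovForm CovForm.OneTyped CovForm.TypedRed

namespace StarPattern

section ChainLeaves

variable {V : Type*} {E : Type*} [Fintype E] [DecidableEq E] {R : Type*} [Field R]

/-- The three assignments with counts `(0, 1, 2)`: one copy in state `1`, two in state `2`. -/
lemma assignments_zero_one_two :
    assignments (r := 2) ![0, 1, 2] = {![1, 2, 2], ![2, 1, 2], ![2, 2, 1]} := by
  decide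

/-- The chain `∅ ⊂ p ⊂ S` with counts `(0, 1, 2)`: `p` in one copy, `S` in the other two. -/
theorem chainCoeff_zero_one_two (ends : E → Sym2 V) (o a₁ a₂ a₃ b : V) (s₁ s₂ s₃ : E)
    (F₀ : Finset E) (z₀ : Config E) (τ : E → ℕ) (p S : Bool × Bool × Bool) :
    chainCoeff (R := R) ends o a₁ a₂ a₃ b s₁ s₂ s₃ F₀ z₀ τ ![(false, false, false), p, S]
        ![0, 1, 2] =
      patCount ends o a₁ a₂ a₃ b s₁ s₂ s₃ F₀ z₀ τ p S S +
      patCount ends o a₁ a₂ a₃ b s₁ s₂ s₃ F₀ z₀ τ S p S +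
      patCount ends o a₁ a₂ a₃ b s₁ s₂ s₃ F₀ z₀ τ S S p := by
  unfold chainCoeff
  rw [assignments_zero_one_two]
  rw [Finset.sum_insert (by decide), Finset.sum_insert (by decide), Finset.sum_singleton]
  simp only [Matrix.cons_val_zero, Matrix.cons_val_one, Matrix.head_cons, Matrix.cons_val_two,
    Matrix.tail_cons]
  ring

/-- The unique assignment with counts `(0, 3)`. -/
lemma assignments_zero_three : assignments (r := 1) ![0, 3] = {![1, 1, 1]} := by decide

/-- The chain `∅ ⊂ P` with counts `(0, 3)` is the type-`3` base `B(P₃)`. -/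
theorem Bfull_eq_chainCoeff (ends : E → Sym2 V) (o a₁ a₂ a₃ b : V) (s₁ s₂ s₃ : E)
    (F₀ : Finset E) (z₀ : Config E) (τ : E → ℕ) (P : Bool × Bool × Bool) :
    Bfull (R := R) ends o a₁ a₂ a₃ b s₁ s₂ s₃ F₀ z₀ τ P =
      chainCoeff ends o a₁ a₂ a₃ b s₁ s₂ s₃ F₀ z₀ τ ![(false, false, false), P] ![0, 3] := by
  unfold chainCoeff Bfull
  rw [assignments_zero_three, Finset.sum_singleton]
  simp only [Matrix.cons_val_zero, Matrix.cons_val_one, Matrix.head_cons, Matrix.cons_val_two,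
    Matrix.tail_cons]

/-- `Λ(T;T;c)` is the chain `∅ ⊂ c ⊂ T` with counts `(0, 1, 2)`. -/
theorem Ltt_T_eq_chainCoeff (ends : E → Sym2 V) (o a₁ a₂ a₃ b : V) (s₁ s₂ s₃ : E)
    (F₀ : Finset E) (z₀ : Config E) (τ : E → ℕ) (c : Bool × Bool × Bool) :
    Ltt (R := R) ends o a₁ a₂ a₃ b s₁ s₂ s₃ F₀ z₀ τ (true, true, true) c =
      chainCoeff ends o a₁ a₂ a₃ b s₁ s₂ s₃ F₀ z₀ τ
        ![(false, false, false), c, (true, true, true)] ![0, 1, 2] := by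
  rw [chainCoeff_zero_one_two]; unfold Ltt; ring

end ChainLeaves

section Moebius

variable {V : Type*} {E : Type*} [Fintype E] [DecidableEq E] {R : Type*} [Field R]

/-- **The first Möbius coefficient at `(2,1)`**: `f(a) − f(∅)`. -/
theorem moebius_21_one (ends : E → Sym2 V) (o a₁ a₂ a₃ b : V) (s₁ s₂ s₃ : E) (F₀ : Finset E)
    (z₀ : Config E) (τ : E → ℕ) :
    Bplace2 (R := R) ends o a₁ a₂ a₃ b s₁ s₂ s₃ F₀ z₀ τ (true, true, true) (true, true, false)
      placements2 placements - Btype2 (R := R) ends o a₁ a₂ a₃ b s₁ s₂ s₃ F₀ z₀ τ (true, true, true)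
      = Ltt ends o a₁ a₂ a₃ b s₁ s₂ s₃ F₀ z₀ τ (true, true, true) (true, true, false) + Btype2 ends
      o a₁ a₂ a₃ b s₁ s₂ s₃ F₀ z₀ τ (true, true, true) := by
  rw [refine_21_01]; ring

/-- **The second Möbius coefficient at `(2,1)`**: `f(ab) − f(a) − f(b) + f(∅)`. -/
theorem moebius_21_two (ends : E → Sym2 V) (o a₁ a₂ a₃ b : V) (s₁ s₂ s₃ : E) (F₀ : Finset E)
    (z₀ : Config E) (τ : E → ℕ) :
    Bplace3 (R := R) ends o a₁ a₂ a₃ b s₁ s₂ s₃ F₀ z₀ τ (true, true, true) (true, true, false)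
      (true, false, true) placements2 placements placements - Bplace2 (R := R) ends o a₁ a₂ a₃ b s₁
      s₂ s₃ F₀ z₀ τ (true, true, true) (true, true, false) placements2 placements - Bplace2 (R := R)
      ends o a₁ a₂ a₃ b s₁ s₂ s₃ F₀ z₀ τ (true, true, true) (true, false, true) placements2
      placements + Btype2 (R := R) ends o a₁ a₂ a₃ b s₁ s₂ s₃ F₀ z₀ τ (true, true, true) = 3 * Bfull
      ends o a₁ a₂ a₃ b s₁ s₂ s₃ F₀ z₀ τ (true, true, true) + Ltt ends o a₁ a₂ a₃ b s₁ s₂ s₃ F₀ z₀ τ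
      (true, true, true) (true, true, false) + Ltt ends o a₁ a₂ a₃ b s₁ s₂ s₃ F₀ z₀ τ
      (true, true, true) (true, false, true) + Btype2 ends o a₁ a₂ a₃ b s₁ s₂ s₃ F₀ z₀ τ
      (true, true, true) := by
  rw [refine_21_0102, refine_21_01, refine_21_02]; ring

/-- **The third Möbius coefficient at `(2,1)`**. -/
theorem moebius_21_three (ends : E → Sym2 V) (o a₁ a₂ a₃ b : V) (s₁ s₂ s₃ : E) (F₀ : Finset E)
    (z₀ : Config E) (τ : E → ℕ) :
    Bplace4 (R := R) ends o a₁ a₂ a₃ b s₁ s₂ s₃ F₀ z₀ τ (true, true, true) (true, true, false)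
      (true, false, true) (false, true, true) placements2 placements placements placements -
      (Bplace3 (R := R) ends o a₁ a₂ a₃ b s₁ s₂ s₃ F₀ z₀ τ (true, true, true) (true, true, false)
      (true, false, true) placements2 placements placements + Bplace3 (R := R) ends o a₁ a₂ a₃ b s₁
      s₂ s₃ F₀ z₀ τ (true, true, true) (true, true, false) (false, true, true) placements2
      placements placements + Bplace3 (R := R) ends o a₁ a₂ a₃ b s₁ s₂ s₃ F₀ z₀ τ (true, true, true)
      (true, false, true) (false, true, true) placements2 placements placements) + (Bplace2 (R := R)
      ends o a₁ a₂ a₃ b s₁ s₂ s₃ F₀ z₀ τ (true, true, true) (true, true, false) placements2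
      placements + Bplace2 (R := R) ends o a₁ a₂ a₃ b s₁ s₂ s₃ F₀ z₀ τ (true, true, true)
      (true, false, true) placements2 placements + Bplace2 (R := R) ends o a₁ a₂ a₃ b s₁ s₂ s₃ F₀ z₀
      τ (true, true, true) (false, true, true) placements2 placements) - Btype2 (R := R) ends o a₁
      a₂ a₃ b s₁ s₂ s₃ F₀ z₀ τ (true, true, true) = 12 * Bfull ends o a₁ a₂ a₃ b s₁ s₂ s₃ F₀ z₀ τ
      (true, true, true) + (Ltt ends o a₁ a₂ a₃ b s₁ s₂ s₃ F₀ z₀ τ (true, true, true)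
      (true, true, false) + Ltt ends o a₁ a₂ a₃ b s₁ s₂ s₃ F₀ z₀ τ (true, true, true)
      (true, false, true) + Ltt ends o a₁ a₂ a₃ b s₁ s₂ s₃ F₀ z₀ τ (true, true, true)
      (false, true, true)) + Btype2 ends o a₁ a₂ a₃ b s₁ s₂ s₃ F₀ z₀ τ (true, true, true) := by
  rw [refine_21_010212, refine_21_0102, refine_21_0112, refine_21_0212, refine_21_01, refine_21_02,
    refine_21_12]
  ring

/-- **The first Möbius coefficient at `(2,2)`**: `f(a) − f(∅)`. -/
theorem moebius_22_one (ends : E → Sym2 V) (o a₁ a₂ a₃ b : V) (s₁ s₂ s₃ : E) (F₀ : Finset E)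
    (z₀ : Config E) (τ : E → ℕ) :
    Bplace2 (R := R) ends o a₁ a₂ a₃ b s₁ s₂ s₃ F₀ z₀ τ (true, true, true) (true, true, false)
      placements2 placements2 - Btype2 (R := R) ends o a₁ a₂ a₃ b s₁ s₂ s₃ F₀ z₀ τ
      (true, true, true) = 2 * Ltt ends o a₁ a₂ a₃ b s₁ s₂ s₃ F₀ z₀ τ (true, true, true)
      (true, true, false) := by
  rw [refine_22_01]; ring

/-- **The second Möbius coefficient at `(2,2)`**: `f(ab) − f(a) − f(b) + f(∅)`. -/
theorem moebius_22_two (ends : E → Sym2 V) (o a₁ a₂ a₃ b : V) (s₁ s₂ s₃ : E) (F₀ : Finset E)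
    (z₀ : Config E) (τ : E → ℕ) :
    Bplace3 (R := R) ends o a₁ a₂ a₃ b s₁ s₂ s₃ F₀ z₀ τ (true, true, true) (true, true, false)
      (true, false, true) placements2 placements2 placements2 - Bplace2 (R := R) ends o a₁ a₂ a₃ b
      s₁ s₂ s₃ F₀ z₀ τ (true, true, true) (true, true, false) placements2 placements2 - Bplace2
      (R := R) ends o a₁ a₂ a₃ b s₁ s₂ s₃ F₀ z₀ τ (true, true, true) (true, false, true) placements2
      placements2 + Btype2 (R := R) ends o a₁ a₂ a₃ b s₁ s₂ s₃ F₀ z₀ τ (true, true, true) = 12 *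
      Bfull ends o a₁ a₂ a₃ b s₁ s₂ s₃ F₀ z₀ τ (true, true, true) := by
  rw [refine_22_0102, refine_22_01, refine_22_02]; ring

/-- **The third Möbius coefficient at `(2,2)`**. -/
theorem moebius_22_three (ends : E → Sym2 V) (o a₁ a₂ a₃ b : V) (s₁ s₂ s₃ : E) (F₀ : Finset E)
    (z₀ : Config E) (τ : E → ℕ) :
    Bplace4 (R := R) ends o a₁ a₂ a₃ b s₁ s₂ s₃ F₀ z₀ τ (true, true, true) (true, true, false)
      (true, false, true) (false, true, true) placements2 placements2 placements2 placements2 -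
      (Bplace3 (R := R) ends o a₁ a₂ a₃ b s₁ s₂ s₃ F₀ z₀ τ (true, true, true) (true, true, false)
      (true, false, true) placements2 placements2 placements2 + Bplace3 (R := R) ends o a₁ a₂ a₃ b
      s₁ s₂ s₃ F₀ z₀ τ (true, true, true) (true, true, false) (false, true, true) placements2
      placements2 placements2 + Bplace3 (R := R) ends o a₁ a₂ a₃ b s₁ s₂ s₃ F₀ z₀ τ
      (true, true, true) (true, false, true) (false, true, true) placements2 placements2
      placements2) + (Bplace2 (R := R) ends o a₁ a₂ a₃ b s₁ s₂ s₃ F₀ z₀ τ (true, true, true)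
      (true, true, false) placements2 placements2 + Bplace2 (R := R) ends o a₁ a₂ a₃ b s₁ s₂ s₃ F₀
      z₀ τ (true, true, true) (true, false, true) placements2 placements2 + Bplace2 (R := R) ends o
      a₁ a₂ a₃ b s₁ s₂ s₃ F₀ z₀ τ (true, true, true) (false, true, true) placements2 placements2) -
      Btype2 (R := R) ends o a₁ a₂ a₃ b s₁ s₂ s₃ F₀ z₀ τ (true, true, true) = 24 * Bfull ends o a₁
      a₂ a₃ b s₁ s₂ s₃ F₀ z₀ τ (true, true, true) := by
  rw [refine_22_010212, refine_22_0102, refine_22_0112, refine_22_0212, refine_22_01, refine_22_02,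
    refine_22_12]
  ring

end Moebius

section Signs

variable {V : Type*} {E : Type*} [Fintype E] [DecidableEq E] {R : Type*} [Field R] [LinearOrder R]
  [IsStrictOrderedRing R]

omit [IsStrictOrderedRing R] in
/-- Under 2′TRI-CH the type-`3` base of the triple is nonnegative. -/
theorem Bfull_T_nonneg_of_triCH (ends : E → Sym2 V) (o a₁ a₂ a₃ b : V) (s₁ s₂ s₃ : E)
    (F₀ : Finset E) (z₀ : Config E) (τ : E → ℕ)
    (hCH : TriCH (R := R) ends o a₁ a₂ a₃ b s₁ s₂ s₃ F₀ z₀ τ) :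
    0 ≤ Bfull (R := R) ends o a₁ a₂ a₃ b s₁ s₂ s₃ F₀ z₀ τ (true, true, true) := by
  rw [Bfull_eq_chainCoeff]
  exact hCH 1 _ isChain_T ![0, 3] (by decide)

omit [IsStrictOrderedRing R] in
/-- Under 2′TRI-CH the leaves `Λ(T;T;c)`, `c ∈ {01, 02, 12}`, are nonnegative. -/
theorem Ltt_T_nonneg_of_triCH (ends : E → Sym2 V) (o a₁ a₂ a₃ b : V) (s₁ s₂ s₃ : E)
    (F₀ : Finset E) (z₀ : Config E) (τ : E → ℕ)
    (hCH : TriCH (R := R) ends o a₁ a₂ a₃ b s₁ s₂ s₃ F₀ z₀ τ) (c : Bool × Bool × Bool)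
    (hc : c ∈ placements2) :
    0 ≤ Ltt (R := R) ends o a₁ a₂ a₃ b s₁ s₂ s₃ F₀ z₀ τ (true, true, true) c := by
  rw [Ltt_T_eq_chainCoeff]
  simp only [placements2, Finset.mem_insert, Finset.mem_singleton] at hc
  rcases hc with rfl | rfl | rfl
  · exact hCH 2 _ isChain_01_T ![0, 1, 2] (by decide)
  · exact hCH 2 _ isChain_02_T ![0, 1, 2] (by decide)
  · exact hCH 2 _ isChain_12_T ![0, 1, 2] (by decide)

/-- **Under 2′TRI-CH the Möbius coefficients at `(2,1)` are nonnegative** (complete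
monotonicity of the triple at `(2,1)` from chain positivity alone). -/
theorem moebius_21_nonneg_of_triCH (ends : E → Sym2 V) (o a₁ a₂ a₃ b : V) (s₁ s₂ s₃ : E) (F₀ :
  Finset E)
    (z₀ : Config E) (τ : E → ℕ)
    (hCH : TriCH (R := R) ends o a₁ a₂ a₃ b s₁ s₂ s₃ F₀ z₀ τ) :
    0 ≤ Bplace2 (R := R) ends o a₁ a₂ a₃ b s₁ s₂ s₃ F₀ z₀ τ (true, true, true) (true, true, false)
      placements2 placements - Btype2 (R := R) ends o a₁ a₂ a₃ b s₁ s₂ s₃ F₀ z₀ τ (true, true, true)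
      ∧
    0 ≤ Bplace3 (R := R) ends o a₁ a₂ a₃ b s₁ s₂ s₃ F₀ z₀ τ (true, true, true) (true, true, false)
      (true, false, true) placements2 placements placements - Bplace2 (R := R) ends o a₁ a₂ a₃ b s₁
      s₂ s₃ F₀ z₀ τ (true, true, true) (true, true, false) placements2 placements - Bplace2 (R := R)
      ends o a₁ a₂ a₃ b s₁ s₂ s₃ F₀ z₀ τ (true, true, true) (true, false, true) placements2
      placements + Btype2 (R := R) ends o a₁ a₂ a₃ b s₁ s₂ s₃ F₀ z₀ τ (true, true, true) ∧
    0 ≤ Bplace4 (R := R) ends o a₁ a₂ a₃ b s₁ s₂ s₃ F₀ z₀ τ (true, true, true) (true, true, false)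
      (true, false, true) (false, true, true) placements2 placements placements placements -
      (Bplace3 (R := R) ends o a₁ a₂ a₃ b s₁ s₂ s₃ F₀ z₀ τ (true, true, true) (true, true, false)
      (true, false, true) placements2 placements placements + Bplace3 (R := R) ends o a₁ a₂ a₃ b s₁
      s₂ s₃ F₀ z₀ τ (true, true, true) (true, true, false) (false, true, true) placements2
      placements placements + Bplace3 (R := R) ends o a₁ a₂ a₃ b s₁ s₂ s₃ F₀ z₀ τ (true, true, true)
      (true, false, true) (false, true, true) placements2 placements placements) + (Bplace2 (R := R)
      ends o a₁ a₂ a₃ b s₁ s₂ s₃ F₀ z₀ τ (true, true, true) (true, true, false) placements2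
      placements + Bplace2 (R := R) ends o a₁ a₂ a₃ b s₁ s₂ s₃ F₀ z₀ τ (true, true, true)
      (true, false, true) placements2 placements + Bplace2 (R := R) ends o a₁ a₂ a₃ b s₁ s₂ s₃ F₀ z₀
      τ (true, true, true) (false, true, true) placements2 placements) - Btype2 (R := R) ends o a₁
      a₂ a₃ b s₁ s₂ s₃ F₀ z₀ τ (true, true, true) := by
  rw [moebius_21_one, moebius_21_two, moebius_21_three]
  have h2 := Btype2_T_nonneg_of_triCH ends o a₁ a₂ a₃ b s₁ s₂ s₃ F₀ z₀ τ hCH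
  have h3 := Bfull_T_nonneg_of_triCH ends o a₁ a₂ a₃ b s₁ s₂ s₃ F₀ z₀ τ hCH
  have h01 := Ltt_T_nonneg_of_triCH ends o a₁ a₂ a₃ b s₁ s₂ s₃ F₀ z₀ τ hCH (true, true, false) (by
    simp [placements2])
  have h02 := Ltt_T_nonneg_of_triCH ends o a₁ a₂ a₃ b s₁ s₂ s₃ F₀ z₀ τ hCH (true, false, true) (by
    simp [placements2])
  have h12 := Ltt_T_nonneg_of_triCH ends o a₁ a₂ a₃ b s₁ s₂ s₃ F₀ z₀ τ hCH (false, true, true) (by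
    simp [placements2])
  refine ⟨?_, ?_, ?_⟩ <;> linarith

/-- **Under 2′TRI-CH the Möbius coefficients at `(2,2)` are nonnegative** (complete
monotonicity of the triple at `(2,2)` from chain positivity alone). -/
theorem moebius_22_nonneg_of_triCH (ends : E → Sym2 V) (o a₁ a₂ a₃ b : V) (s₁ s₂ s₃ : E) (F₀ :
  Finset E)
    (z₀ : Config E) (τ : E → ℕ)
    (hCH : TriCH (R := R) ends o a₁ a₂ a₃ b s₁ s₂ s₃ F₀ z₀ τ) :
    0 ≤ Bplace2 (R := R) ends o a₁ a₂ a₃ b s₁ s₂ s₃ F₀ z₀ τ (true, true, true) (true, true, false)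
      placements2 placements2 - Btype2 (R := R) ends o a₁ a₂ a₃ b s₁ s₂ s₃ F₀ z₀ τ
      (true, true, true) ∧
    0 ≤ Bplace3 (R := R) ends o a₁ a₂ a₃ b s₁ s₂ s₃ F₀ z₀ τ (true, true, true) (true, true, false)
      (true, false, true) placements2 placements2 placements2 - Bplace2 (R := R) ends o a₁ a₂ a₃ b
      s₁ s₂ s₃ F₀ z₀ τ (true, true, true) (true, true, false) placements2 placements2 - Bplace2
      (R := R) ends o a₁ a₂ a₃ b s₁ s₂ s₃ F₀ z₀ τ (true, true, true) (true, false, true) placements2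
      placements2 + Btype2 (R := R) ends o a₁ a₂ a₃ b s₁ s₂ s₃ F₀ z₀ τ (true, true, true) ∧
    0 ≤ Bplace4 (R := R) ends o a₁ a₂ a₃ b s₁ s₂ s₃ F₀ z₀ τ (true, true, true) (true, true, false)
      (true, false, true) (false, true, true) placements2 placements2 placements2 placements2 -
      (Bplace3 (R := R) ends o a₁ a₂ a₃ b s₁ s₂ s₃ F₀ z₀ τ (true, true, true) (true, true, false)
      (true, false, true) placements2 placements2 placements2 + Bplace3 (R := R) ends o a₁ a₂ a₃ b
      s₁ s₂ s₃ F₀ z₀ τ (true, true, true) (true, true, false) (false, true, true) placements2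
      placements2 placements2 + Bplace3 (R := R) ends o a₁ a₂ a₃ b s₁ s₂ s₃ F₀ z₀ τ
      (true, true, true) (true, false, true) (false, true, true) placements2 placements2
      placements2) + (Bplace2 (R := R) ends o a₁ a₂ a₃ b s₁ s₂ s₃ F₀ z₀ τ (true, true, true)
      (true, true, false) placements2 placements2 + Bplace2 (R := R) ends o a₁ a₂ a₃ b s₁ s₂ s₃ F₀
      z₀ τ (true, true, true) (true, false, true) placements2 placements2 + Bplace2 (R := R) ends o
      a₁ a₂ a₃ b s₁ s₂ s₃ F₀ z₀ τ (true, true, true) (false, true, true) placements2 placements2) -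
      Btype2 (R := R) ends o a₁ a₂ a₃ b s₁ s₂ s₃ F₀ z₀ τ (true, true, true) := by
  rw [moebius_22_one, moebius_22_two, moebius_22_three]
  have h2 := Btype2_T_nonneg_of_triCH ends o a₁ a₂ a₃ b s₁ s₂ s₃ F₀ z₀ τ hCH
  have h3 := Bfull_T_nonneg_of_triCH ends o a₁ a₂ a₃ b s₁ s₂ s₃ F₀ z₀ τ hCH
  have h01 := Ltt_T_nonneg_of_triCH ends o a₁ a₂ a₃ b s₁ s₂ s₃ F₀ z₀ τ hCH (true, true, false) (by
    simp [placements2])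
  have h02 := Ltt_T_nonneg_of_triCH ends o a₁ a₂ a₃ b s₁ s₂ s₃ F₀ z₀ τ hCH (true, false, true) (by
    simp [placements2])
  have h12 := Ltt_T_nonneg_of_triCH ends o a₁ a₂ a₃ b s₁ s₂ s₃ F₀ z₀ τ hCH (false, true, true) (by
    simp [placements2])
  refine ⟨?_, ?_, ?_⟩ <;> linarith

end Signs

end StarPattern

end Summit.Ventures.PercRepro2
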